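import Mathlib
import Summits.Ventures.FusionMHD.Models.FluxSurfacePolarRayLevelCurrent
import Literature.MathematicalPhysics.MHD.FluxSurfaceAverage
import Literature.MathematicalPhysics.MHD.MercierFluxForm
import HarnessLib

/-!
# Polar-ray chart, LEVEL direction (V): the thirteen Jardin (8.134) / Glasser–Greene–Johnson inputs of an IMPLICIT flux surface
# (the level set `ψ = u` traced by the glued polar loop) as ONE `Mercier.FluxForm.SurfaceData`, with the profile fields
# `V′, V″, Φ′, Φ″, I′` and the surface average of ANY weight PROVED equal to θ-integrals of explicit kernels along the glued radius

LADDER-GRIDFUSION (F2 item R2 / F1 on the Cerfon–Freidberg rung), cell `gridfusion`, seat `gridfusion-model-7` (g6), 2026-08-27.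
Fifth file of «F2.R2-POLAR-LEVEL-DERIV» (`Models/FluxSurfacePolarRayLevel{,Kernels,Loop,Current}.lean`): the (8.134) BOOKKEEPING,
part 1 (record + profile fields + averages of any weight); part 2 (`…LevelGGJMercier.lean`) does the four named averages and the
criterion as ONE polynomial inequality in six registers.  The typed criterion is gridfusion-lit-3's
`Literature/…/MercierFluxForm.lean` (Jardin 2010 (8.134) VERBATIM on a `SurfaceData` record of thirteen reals); the functionals are
`Literature/…/FluxSurfaceAverage.lean` (Jardin (5.29)–(5.35) = Freidberg (6.22)/(6.27)/(6.35)).  gridfusion-model-5's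
`Solovev.lcGGJData` (`Literature/…/SolovevFluxSurfaceGGJData.lean`) is the same record for the CLOSED-FORM loop of a Lee–Cerfon / PCF
Solov'ev surface; this file is its twin for a surface with NO closed form — a level set of a `C¹` flux function star-shaped about
`(R_c, Z_c)` and certified panel by panel (`LevelLoop`, ★ #117's shape) — where the surface label IS the level `u`, so every label
derivative is a plain `deriv` in `u` (no inverse radius map).

CONVENTIONS (= `SolovevFluxSurfaceGGJData.lean`, stated once): label `ψ := Ψ = u`; JARDIN's orientation `B = ∇φ × ∇Ψ + g∇φ`
(5.24), physical poloidal flux `Ψ_p = 2πΨ` (5.32) ⇒ `Ψ′ = 2π`, `Ψ″ = 0`; CONSTANT free function `F ≡ g` (`gg′ = 0`, `K′ = 0`);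
`μ₀RJ_φ = Δ*Ψ` (Jardin (4.55)) ⇒ `σB² = J·B = J_φB_φ = gΔ*Ψ/R²` (rationalised `μ₀ → 1` as in (8.134)); and the Grad–Shafranov
equation with linear pressure, `Δ*Ψ = C·R²` on the region swept by the surface (`μ₀p′ = −Δ*Ψ/R² = −C`): the LC/PCF Solov'ev family
(`C = C_s`, `gsOperator_psiLC`) and the `α = 0` Cerfon–Freidberg family (`C = 1`, `CFIterLike.gsOperator_of_isInstance`) are both
in this class.  The tree's `GradShafranov.fieldBR/muJphi` are in FREIDBERG's (mirror) orientation; by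
`Mercier.FluxForm.SurfaceData.mercierF_mirror` the criterion is the same for the mirrored record — never mix.

WHAT IS PROVED ([folklore] calculus + the printed functionals, which carry their sources):
* §1 `ggjData g C ψ R_c Z_c u : SurfaceData` — `V′ = volumeDerivE`, `V″ = d/du` of it, `Ψ′ = 2π`, `Ψ″ = 0`,
  `Φ′ = toroidalFluxDerivJ g` (5.31), `Φ″ = d/du` of it, `I′ = d/du` of `toroidalCurrentJ 1` (5.34), `K′ = 0`, `p′ = −C`, and the
  four averages as `surfaceAverageE` of `B²/|∇Ψ|²`, `(gΔ*Ψ/R²)/|∇Ψ|²`, `(gΔ*Ψ/R²)²/(B²|∇Ψ|²)`, `1/B²` with `B² = fieldBsq (F ≡ g)` —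
  all on the glued loop `loop R_c Z_c ρ_u`, `ρ_u = rayRadius ψ R_c Z_c u`.
* §2 Under a `LevelLoop` (partition of `[0, 2π]` into level panels, common slope field `D = ∂_sψ(ray)`), the Fréchet derivative
  `L θ s` of `ψ` at the ray points, `R = R_c + s cos θ > 0` on the boxes, and — where needed — a jointly continuous `D₁ = ∂_s D` and
  the identification `ψ_R² + ψ_Z² = G` (gradient-squared field along rays, `∂_sG = G₁`), FOR EVERY admissible level `u`:
  **`LevelLoop.surfaceAverageE_eq`** `⟨a⟩ = ∫₀^{2π} a(γθ)·volKernel ÷ ∫₀^{2π} volKernel` for ANY weight `a` (Jardin (5.30);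
  ★ #88's identity with weight `R²a`; no integrability needed); `integral_volKernel_pos`, `volumeDerivE_pos` (`V′ > 0`);
  `toroidalFluxDerivJ_eq_polar` (`Φ′ = g∫₀^{2π} polarKernel`), `hasDerivAt_toroidalFluxDerivJ` (`dΦ′/du = g∫₀^{2π} polarKernelDs/D`),
  `hasDerivAt_toroidalCurrentJ` (`dI/du = ∫₀^{2π} curKernelDs/D`); the field identities `ggjData_V'`, `_V'_pos`, `_V''`, `_Φ'`, `_Φ''`,
  `_I'` (each ONE θ-integral of a named kernel along `ρ_u`) and `_Ψ'`, `_Ψ''`, `_K'`, `_p'` (`rfl`).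
* §3 `mercierF_ggjData` — Jardin's `F` of the surface in the poloidal-flux-label form (`mercierF_of_poloidalFluxLabel`, the `I′`
  field drops since `Ψ″ = 0`), `mercierF_ggjData_indep_I'`.
MODELLED: ideal MHD, static axisymmetric equilibrium with constant `F` and `Δ*Ψ = C·R²` (Solov'ev-class profiles), nested
star-shaped flux surfaces about `(R_c, Z_c)`; the criterion is NECESSARY for ideal interchange stability, not sufficient — a sign of
`F` on a named model surface is a statement about that MODEL, never about a device.  NOT CLAIMED: any value for any equilibrium
(instances: `Models/CerfonFreidbergIterLikeQHalf*.lean`); the surface-averaged force balance for these data; that an instance's code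
lists are `∂_sψ`, `∂²_sψ`, `|∇ψ|²` beyond the hypotheses `hψ`/`hD₁`/`hG`.
-/

noncomputable section

open Real Set Filter Topology MeasureTheory intervalIntegral
open Literature.MathematicalPhysics.MHD Literature.MathematicalPhysics.MHD.GradShafranov
  Literature.MathematicalPhysics.MHD.FluxGeometry Literature.MathematicalPhysics.MHD.Mercier.FluxForm

namespace Summit.Ventures.FusionMHD.Models

namespace PolarRay

/-! ## §0 Pointwise dictionary at a ray point -/

section pointwise

variable {ψ : ℝ → ℝ → ℝ} {R Z : ℝ} {L : ℝ × ℝ →L[ℝ] ℝ}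

/-- `|∇ψ|² = ψ_R² + ψ_Z²` with the partials read off the Fréchet derivative. [folklore] -/
theorem gradSq_of_hasFDerivAt (hψ : HasFDerivAt (fun p : ℝ × ℝ => ψ p.1 p.2) L (R, Z)) :
    gradSq ψ R Z = (L (1, 0)) ^ 2 + (L (0, 1)) ^ 2 := by
  obtain ⟨h1, h2⟩ := dR_dZ_of_hasFDerivAt hψ
  unfold gradSq
  rw [h1, h2]

/-- `B² = (g² + ψ_R² + ψ_Z²)/R²` for a constant free function `F ≡ g` (`R ≠ 0`). [cite: Freidberg2014, §12.3 eq. (12.32)] -/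
theorem fieldBsq_const_of_hasFDerivAt (g : ℝ) (hψ : HasFDerivAt (fun p : ℝ × ℝ => ψ p.1 p.2) L (R, Z)) (hR : R ≠ 0) :
    fieldBsq (fun _ => g) ψ R Z = (g ^ 2 + ((L (1, 0)) ^ 2 + (L (0, 1)) ^ 2)) / R ^ 2 := by
  rw [fieldBsq_const ψ Z hR, gradSq_of_hasFDerivAt hψ]

end pointwise

/-! ## §1 The record: the thirteen (8.134) inputs of the level surface `ψ = u` in the polar-ray chart -/

/-- THE GGJ / MERCIER (8.134) INPUTS OF THE IMPLICIT SURFACE `ψ = u` traced by the glued polar loop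
`γ_u = loop R_c Z_c ρ_u` (`ρ_u = rayRadius ψ R_c Z_c u`), for a constant free function `F ≡ g` and Solov'ev-class source
`Δ*Ψ = C·R²`, in the label `ψ := Ψ = u` and JARDIN's orientation (`Ψ_p = 2πΨ`, `μ₀RJ_φ = Δ*Ψ`, rationalised `μ₀ → 1`):
`V′ = dV/dΨ` (5.29)/(6.22); `V″ = dV′/du`; `Ψ′ = 2π`, `Ψ″ = 0` (5.32); `Φ′ = (1/2π)gV′⟨R⁻²⟩` (5.31), `Φ″ = dΦ′/du`;
`I′ = dI/du`, `I` = (5.34) (`μ₀ = 1`); `K′ = 0` (5.33, `g′ = 0`); `p′ = −C`; `⟨B²/|∇Ψ|²⟩`, `⟨σB²/|∇Ψ|²⟩`, `⟨σ²B²/|∇Ψ|²⟩`,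
`⟨1/B²⟩` with `σB² = gΔ*Ψ/R²` and `B² = fieldBsq (F ≡ g)`.  The same construction as `Solovev.lcGGJData`, with the label
derivative taken in the level.  MODELLED: ideal MHD, Solov'ev-class profiles, nested star-shaped surfaces.
[cite: Jardin2010, §8.5.4 eq. (8.134)] -/
def ggjData (g C : ℝ) (ψ : ℝ → ℝ → ℝ) (Rc Zc u : ℝ) : SurfaceData where
  V' := volumeDerivE ψ (loop Rc Zc (rayRadius ψ Rc Zc u)) (2 * π)
  V'' := deriv (fun v => volumeDerivE ψ (loop Rc Zc (rayRadius ψ Rc Zc v)) (2 * π)) u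
  Ψ' := 2 * π
  Ψ'' := 0
  Φ' := toroidalFluxDerivJ g ψ (loop Rc Zc (rayRadius ψ Rc Zc u)) (2 * π)
  Φ'' := deriv (fun v => toroidalFluxDerivJ g ψ (loop Rc Zc (rayRadius ψ Rc Zc v)) (2 * π)) u
  I' := deriv (fun v => toroidalCurrentJ 1 ψ (loop Rc Zc (rayRadius ψ Rc Zc v)) (2 * π)) u
  K' := 0
  p' := -C
  gB2 := surfaceAverageE ψ (loop Rc Zc (rayRadius ψ Rc Zc u)) (2 * π)
    (fun R Z => fieldBsq (fun _ => g) ψ R Z / gradSq ψ R Z)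
  gσB2 := surfaceAverageE ψ (loop Rc Zc (rayRadius ψ Rc Zc u)) (2 * π)
    (fun R Z => g * gsOperator ψ R Z / R ^ 2 / gradSq ψ R Z)
  gσ2B2 := surfaceAverageE ψ (loop Rc Zc (rayRadius ψ Rc Zc u)) (2 * π)
    (fun R Z => (g * gsOperator ψ R Z / R ^ 2) ^ 2 / (fieldBsq (fun _ => g) ψ R Z * gradSq ψ R Z))
  invB2 := surfaceAverageE ψ (loop Rc Zc (rayRadius ψ Rc Zc u)) (2 * π)
    (fun R Z => 1 / fieldBsq (fun _ => g) ψ R Z)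

/-! ## §2 Under a loop of level panels: every field is one θ-integral along the glued radius -/

namespace LevelLoop

variable {ψ : ℝ → ℝ → ℝ} {Rc Zc uin uout : ℝ} {D D₁ G G₁ : ℝ → ℝ → ℝ} {N : ℕ} {t σ₁ σ₂ : ℕ → ℝ}
  {L : ℝ → ℝ → (ℝ × ℝ →L[ℝ] ℝ)}

/-- **`⟨a⟩ = ∫ a·volKernel ÷ ∫ volKernel` FOR ANY WEIGHT** on the glued loop at every admissible level (Jardin (5.30)
`⟨a⟩ = 2π∮ a dℓ/B_p ÷ V′` with `dℓ/B_p = R·ρ dθ/|D_r|` on the polar loop; ★ #88's identity with weight `R²a`).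
[cite: Jardin2010, §5.3 eq. (5.30)] -/
theorem surfaceAverageE_eq (Λ : LevelLoop ψ Rc Zc uin uout D N t σ₁ σ₂)
    (hψ : ∀ j < N, ∀ θ ∈ Icc (t j) (t (j + 1)), ∀ s ∈ Icc (σ₁ j) (σ₂ j),
      HasFDerivAt (fun p : ℝ × ℝ => ψ p.1 p.2) (L θ s) (rayPoint Rc Zc θ s))
    (hR : ∀ j < N, ∀ θ ∈ Icc (t j) (t (j + 1)), ∀ s ∈ Icc (σ₁ j) (σ₂ j), 0 < Rc + s * cos θ)
    {u : ℝ} (hu : u ∈ Ioo uin uout) (a : ℝ → ℝ → ℝ) :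
    surfaceAverageE ψ (loop Rc Zc (rayRadius ψ Rc Zc u)) (2 * π) a
      = (∫ θ in (0 : ℝ)..(2 * π), a (loop Rc Zc (rayRadius ψ Rc Zc u) θ).1 (loop Rc Zc (rayRadius ψ Rc Zc u) θ).2
            * volKernel Rc D θ (rayRadius ψ Rc Zc u θ))
          / ∫ θ in (0 : ℝ)..(2 * π), volKernel Rc D θ (rayRadius ψ Rc Zc u θ) := by
  obtain ⟨hρ0, hψ', hDeq, hDr, hR'⟩ := Λ.loop_hyps hψ hR hu
  have hlev : ∀ θ ∈ Icc 0 (2 * π), rayProfile ψ Rc Zc θ (rayRadius ψ Rc Zc u θ) = u :=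
    fun θ hθ => (Λ.surface_facts hu hθ).1
  unfold surfaceAverageE
  rw [Λ.volumeDerivE_eq hψ hR hu]
  have h := loopIntegralE_eq_polar_rayRadius (fun R Z => R ^ 2 * a R Z) hlev (Λ.continuousOn_rayRadius hu) hρ0 hψ' hDr hR'
  have e1 : loopIntegralE (loop Rc Zc (rayRadius ψ Rc Zc u)) (2 * π) (fun R Z => a R Z / fieldBpol ψ R Z)
      = loopIntegralE (loop Rc Zc (rayRadius ψ Rc Zc u)) (2 * π)
          (fun R Z => R ^ 2 * a R Z / (R ^ 2 * fieldBpol ψ R Z)) := by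
    unfold loopIntegralE
    apply intervalIntegral.integral_congr
    intro θ hθ
    have hR0 : (loop Rc Zc (rayRadius ψ Rc Zc u) θ).1 ^ 2 ≠ 0 := pow_ne_zero 2 (hR' θ hθ).ne'
    simp only
    rw [mul_div_mul_left _ _ hR0]
  have e2 : loopIntegralE (loop Rc Zc (rayRadius ψ Rc Zc u)) (2 * π) (fun R Z => a R Z / fieldBpol ψ R Z)
      = ∫ θ in (0 : ℝ)..(2 * π), a (loop Rc Zc (rayRadius ψ Rc Zc u) θ).1 (loop Rc Zc (rayRadius ψ Rc Zc u) θ).2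
          * volKernel Rc D θ (rayRadius ψ Rc Zc u θ) := by
    rw [e1, h]
    apply intervalIntegral.integral_congr
    intro θ hθ
    have hRne : Rc + rayRadius ψ Rc Zc u θ * cos θ ≠ 0 := (hR' θ hθ).ne'
    have hDne : D θ (rayRadius ψ Rc Zc u θ) ≠ 0 := (hDeq θ hθ).2.ne'
    simp only
    rw [(hDeq θ hθ).1, abs_of_pos (hDeq θ hθ).2]
    unfold volKernel
    simp only [loop]
    field_simp
  rw [e2, mul_div_mul_left _ _ two_pi_pos.ne']

/-- `θ ↦ volKernel(θ, ρ_u θ)` is continuous on the period and positive there. [folklore] -/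
theorem continuousOn_volKernel_rayRadius (Λ : LevelLoop ψ Rc Zc uin uout D N t σ₁ σ₂) {u : ℝ} (hu : u ∈ Ioo uin uout) :
    ContinuousOn (fun θ => volKernel Rc D θ (rayRadius ψ Rc Zc u θ)) (Icc 0 (2 * π)) := by
  have h := (continuousOn_Icc_of_chain (f := fun θ => volKernel Rc D θ (rayRadius ψ Rc Zc u θ)) N Λ.mono
    fun j hj => (Λ.panel j hj).continuousOn_kernel
      (continuousOn_volKernel (Λ.panel j hj).slopeCont fun p hp => ((Λ.panel j hj).slopePos p.1 hp.1 p.2 hp.2).ne') hu).2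
  rwa [Λ.t_zero, Λ.t_last] at h

/-- **`∫₀^{2π} volKernel > 0`** (the integrand is `R·ρ/D > 0` and continuous). [folklore] -/
theorem integral_volKernel_pos (Λ : LevelLoop ψ Rc Zc uin uout D N t σ₁ σ₂)
    (hψ : ∀ j < N, ∀ θ ∈ Icc (t j) (t (j + 1)), ∀ s ∈ Icc (σ₁ j) (σ₂ j),
      HasFDerivAt (fun p : ℝ × ℝ => ψ p.1 p.2) (L θ s) (rayPoint Rc Zc θ s))
    (hR : ∀ j < N, ∀ θ ∈ Icc (t j) (t (j + 1)), ∀ s ∈ Icc (σ₁ j) (σ₂ j), 0 < Rc + s * cos θ)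
    {u : ℝ} (hu : u ∈ Ioo uin uout) :
    0 < ∫ θ in (0 : ℝ)..(2 * π), volKernel Rc D θ (rayRadius ψ Rc Zc u θ) := by
  obtain ⟨hρ0, -, hDeq, -, hR'⟩ := Λ.loop_hyps hψ hR hu
  have hI : uIcc 0 (2 * π) = Icc 0 (2 * π) := uIcc_of_le two_pi_pos.le
  refine intervalIntegral.intervalIntegral_pos_of_pos_on
    ((Λ.continuousOn_volKernel_rayRadius hu).intervalIntegrable_of_Icc two_pi_pos.le) (fun θ hθ => ?_) two_pi_pos
  have hθ' : θ ∈ uIcc 0 (2 * π) := by rw [hI]; exact Ioo_subset_Icc_self hθ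
  unfold volKernel
  exact div_pos (mul_pos (hR' θ hθ') (hρ0 θ hθ')) (hDeq θ hθ').2

/-- **`V′ > 0`** at every admissible level (regular surface). [cite: Jardin2010, §5.3 eq. (5.29)] -/
theorem volumeDerivE_pos (Λ : LevelLoop ψ Rc Zc uin uout D N t σ₁ σ₂)
    (hψ : ∀ j < N, ∀ θ ∈ Icc (t j) (t (j + 1)), ∀ s ∈ Icc (σ₁ j) (σ₂ j),
      HasFDerivAt (fun p : ℝ × ℝ => ψ p.1 p.2) (L θ s) (rayPoint Rc Zc θ s))
    (hR : ∀ j < N, ∀ θ ∈ Icc (t j) (t (j + 1)), ∀ s ∈ Icc (σ₁ j) (σ₂ j), 0 < Rc + s * cos θ)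
    {u : ℝ} (hu : u ∈ Ioo uin uout) :
    0 < volumeDerivE ψ (loop Rc Zc (rayRadius ψ Rc Zc u)) (2 * π) := by
  rw [Λ.volumeDerivE_eq hψ hR hu]
  exact mul_pos two_pi_pos (Λ.integral_volKernel_pos hψ hR hu)

/-- **`Φ′ = g ∫₀^{2π} polarKernel`** (Jardin (5.31) `Φ′ = 2πq`, `q = (g/2π)∫polarKernel` by the Loop file).
[cite: Jardin2010, §5.3 eq. (5.31)] -/
theorem toroidalFluxDerivJ_eq_polar (Λ : LevelLoop ψ Rc Zc uin uout D N t σ₁ σ₂) (g : ℝ)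
    (hψ : ∀ j < N, ∀ θ ∈ Icc (t j) (t (j + 1)), ∀ s ∈ Icc (σ₁ j) (σ₂ j),
      HasFDerivAt (fun p : ℝ × ℝ => ψ p.1 p.2) (L θ s) (rayPoint Rc Zc θ s))
    (hR : ∀ j < N, ∀ θ ∈ Icc (t j) (t (j + 1)), ∀ s ∈ Icc (σ₁ j) (σ₂ j), 0 < Rc + s * cos θ)
    {u : ℝ} (hu : u ∈ Ioo uin uout) :
    toroidalFluxDerivJ g ψ (loop Rc Zc (rayRadius ψ Rc Zc u)) (2 * π)
      = g * ∫ θ in (0 : ℝ)..(2 * π), polarKernel Rc D θ (rayRadius ψ Rc Zc u θ) := by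
  rw [toroidalFluxDerivJ_eq (Λ.volumeDerivE_pos hψ hR hu).ne' g, Λ.safetyFactorE_eq g hψ hR hu]
  simp only [polarIntegrand_eq_polarKernel]
  have hπ : (π : ℝ) ≠ 0 := Real.pi_ne_zero
  field_simp

/-- **`dΦ′/du = g ∫₀^{2π} polarKernelDs/D` along `ρ_{u₀}`** (`Φ″ = 2π dq/dΨ`; the Loop file's `hasDerivAt_safetyFactorE`).
[cite: Jardin2010, §8.5.4 eq. (8.134)] -/
theorem hasDerivAt_toroidalFluxDerivJ (Λ : LevelLoop ψ Rc Zc uin uout D N t σ₁ σ₂) (g : ℝ)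
    (hψ : ∀ j < N, ∀ θ ∈ Icc (t j) (t (j + 1)), ∀ s ∈ Icc (σ₁ j) (σ₂ j),
      HasFDerivAt (fun p : ℝ × ℝ => ψ p.1 p.2) (L θ s) (rayPoint Rc Zc θ s))
    (hR : ∀ j < N, ∀ θ ∈ Icc (t j) (t (j + 1)), ∀ s ∈ Icc (σ₁ j) (σ₂ j), 0 < Rc + s * cos θ)
    (hD₁ : ∀ j < N, ∀ θ ∈ Icc (t j) (t (j + 1)), ∀ s ∈ Icc (σ₁ j) (σ₂ j), HasDerivAt (D θ) (D₁ θ s) s)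
    (hD₁c : ∀ j < N, ContinuousOn (fun p : ℝ × ℝ => D₁ p.1 p.2) (Icc (t j) (t (j + 1)) ×ˢ Icc (σ₁ j) (σ₂ j)))
    {u₀ : ℝ} (hu₀ : u₀ ∈ Ioo uin uout) :
    HasDerivAt (fun u => toroidalFluxDerivJ g ψ (loop Rc Zc (rayRadius ψ Rc Zc u)) (2 * π))
      (g * ∫ θ in (0 : ℝ)..(2 * π),
        polarKernelDs Rc D D₁ θ (rayRadius ψ Rc Zc u₀ θ) / D θ (rayRadius ψ Rc Zc u₀ θ)) u₀ := by
  have h := Λ.hasDerivAt_safetyFactorE g hψ hR hD₁ hD₁c hu₀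
  have hev : (fun u => toroidalFluxDerivJ g ψ (loop Rc Zc (rayRadius ψ Rc Zc u)) (2 * π))
      =ᶠ[𝓝 u₀] fun u => 2 * π * safetyFactorE g ψ (loop Rc Zc (rayRadius ψ Rc Zc u)) (2 * π) := by
    filter_upwards [Ioo_mem_nhds hu₀.1 hu₀.2] with u hu
    exact toroidalFluxDerivJ_eq (Λ.volumeDerivE_pos hψ hR hu).ne' g
  refine ((h.const_mul (2 * π)).congr_of_eventuallyEq hev).congr_deriv ?_
  have hπ : (π : ℝ) ≠ 0 := Real.pi_ne_zero
  field_simp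

/-- **`dI/du = ∫₀^{2π} curKernelDs/D` along `ρ_{u₀}`** for Jardin's `I` (5.34) (`= toroidalCurrentE`, Freidberg (6.27), on
regular surfaces; the Current file's `hasDerivAt_toroidalCurrentE` with `μ₀ = 1`). [cite: Jardin2010, §8.5.4 eq. (8.134)] -/
theorem hasDerivAt_toroidalCurrentJ (Λ : LevelLoop ψ Rc Zc uin uout D N t σ₁ σ₂)
    (hψ : ∀ j < N, ∀ θ ∈ Icc (t j) (t (j + 1)), ∀ s ∈ Icc (σ₁ j) (σ₂ j),
      HasFDerivAt (fun p : ℝ × ℝ => ψ p.1 p.2) (L θ s) (rayPoint Rc Zc θ s))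
    (hR : ∀ j < N, ∀ θ ∈ Icc (t j) (t (j + 1)), ∀ s ∈ Icc (σ₁ j) (σ₂ j), 0 < Rc + s * cos θ)
    (hG : ∀ j < N, ∀ θ ∈ Icc (t j) (t (j + 1)), ∀ s ∈ Icc (σ₁ j) (σ₂ j), (L θ s (1, 0)) ^ 2 + (L θ s (0, 1)) ^ 2 = G θ s)
    (hD₁ : ∀ j < N, ∀ θ ∈ Icc (t j) (t (j + 1)), ∀ s ∈ Icc (σ₁ j) (σ₂ j), HasDerivAt (D θ) (D₁ θ s) s)
    (hD₁c : ∀ j < N, ContinuousOn (fun p : ℝ × ℝ => D₁ p.1 p.2) (Icc (t j) (t (j + 1)) ×ˢ Icc (σ₁ j) (σ₂ j)))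
    (hG₁ : ∀ j < N, ∀ θ ∈ Icc (t j) (t (j + 1)), ∀ s ∈ Icc (σ₁ j) (σ₂ j), HasDerivAt (G θ) (G₁ θ s) s)
    (hGc : ∀ j < N, ContinuousOn (fun p : ℝ × ℝ => G p.1 p.2) (Icc (t j) (t (j + 1)) ×ˢ Icc (σ₁ j) (σ₂ j)))
    (hG₁c : ∀ j < N, ContinuousOn (fun p : ℝ × ℝ => G₁ p.1 p.2) (Icc (t j) (t (j + 1)) ×ˢ Icc (σ₁ j) (σ₂ j)))
    {u₀ : ℝ} (hu₀ : u₀ ∈ Ioo uin uout) :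
    HasDerivAt (fun u => toroidalCurrentJ 1 ψ (loop Rc Zc (rayRadius ψ Rc Zc u)) (2 * π))
      (∫ θ in (0 : ℝ)..(2 * π),
        curKernelDs Rc D D₁ G G₁ θ (rayRadius ψ Rc Zc u₀ θ) / D θ (rayRadius ψ Rc Zc u₀ θ)) u₀ := by
  have h := Λ.hasDerivAt_toroidalCurrentE 1 hψ hR hG hD₁ hD₁c hG₁ hGc hG₁c hu₀
  have hev : (fun u => toroidalCurrentJ 1 ψ (loop Rc Zc (rayRadius ψ Rc Zc u)) (2 * π))
      =ᶠ[𝓝 u₀] fun u => toroidalCurrentE 1 ψ (loop Rc Zc (rayRadius ψ Rc Zc u)) (2 * π) := by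
    filter_upwards [Ioo_mem_nhds hu₀.1 hu₀.2] with u hu
    exact toroidalCurrentJ_eq_toroidalCurrentE (Λ.volumeDerivE_pos hψ hR hu).ne' 1
  refine (h.congr_of_eventuallyEq hev).congr_deriv ?_
  rw [one_div_one, one_mul]

/-! ### The thirteen fields -/

/-- `V′ = 2π∫₀^{2π} volKernel`. [cite: Jardin2010, §5.3 eq. (5.29)] -/
theorem ggjData_V' (Λ : LevelLoop ψ Rc Zc uin uout D N t σ₁ σ₂) (g C : ℝ)
    (hψ : ∀ j < N, ∀ θ ∈ Icc (t j) (t (j + 1)), ∀ s ∈ Icc (σ₁ j) (σ₂ j),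
      HasFDerivAt (fun p : ℝ × ℝ => ψ p.1 p.2) (L θ s) (rayPoint Rc Zc θ s))
    (hR : ∀ j < N, ∀ θ ∈ Icc (t j) (t (j + 1)), ∀ s ∈ Icc (σ₁ j) (σ₂ j), 0 < Rc + s * cos θ)
    {u : ℝ} (hu : u ∈ Ioo uin uout) :
    (ggjData g C ψ Rc Zc u).V' = 2 * π * ∫ θ in (0 : ℝ)..(2 * π), volKernel Rc D θ (rayRadius ψ Rc Zc u θ) :=
  Λ.volumeDerivE_eq hψ hR hu

/-- `V′ ≠ 0`. [cite: Jardin2010, §5.3 eq. (5.29)] -/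
theorem ggjData_V'_pos (Λ : LevelLoop ψ Rc Zc uin uout D N t σ₁ σ₂) (g C : ℝ)
    (hψ : ∀ j < N, ∀ θ ∈ Icc (t j) (t (j + 1)), ∀ s ∈ Icc (σ₁ j) (σ₂ j),
      HasFDerivAt (fun p : ℝ × ℝ => ψ p.1 p.2) (L θ s) (rayPoint Rc Zc θ s))
    (hR : ∀ j < N, ∀ θ ∈ Icc (t j) (t (j + 1)), ∀ s ∈ Icc (σ₁ j) (σ₂ j), 0 < Rc + s * cos θ)
    {u : ℝ} (hu : u ∈ Ioo uin uout) :
    0 < (ggjData g C ψ Rc Zc u).V' :=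
  Λ.volumeDerivE_pos hψ hR hu

/-- `V″ = 2π∫₀^{2π} volKernelDs/D` along `ρ_u`. [cite: Jardin2010, §8.5.4 eq. (8.134)] -/
theorem ggjData_V'' (Λ : LevelLoop ψ Rc Zc uin uout D N t σ₁ σ₂) (g C : ℝ)
    (hψ : ∀ j < N, ∀ θ ∈ Icc (t j) (t (j + 1)), ∀ s ∈ Icc (σ₁ j) (σ₂ j),
      HasFDerivAt (fun p : ℝ × ℝ => ψ p.1 p.2) (L θ s) (rayPoint Rc Zc θ s))
    (hR : ∀ j < N, ∀ θ ∈ Icc (t j) (t (j + 1)), ∀ s ∈ Icc (σ₁ j) (σ₂ j), 0 < Rc + s * cos θ)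
    (hD₁ : ∀ j < N, ∀ θ ∈ Icc (t j) (t (j + 1)), ∀ s ∈ Icc (σ₁ j) (σ₂ j), HasDerivAt (D θ) (D₁ θ s) s)
    (hD₁c : ∀ j < N, ContinuousOn (fun p : ℝ × ℝ => D₁ p.1 p.2) (Icc (t j) (t (j + 1)) ×ˢ Icc (σ₁ j) (σ₂ j)))
    {u : ℝ} (hu : u ∈ Ioo uin uout) :
    (ggjData g C ψ Rc Zc u).V''
      = 2 * π * ∫ θ in (0 : ℝ)..(2 * π), volKernelDs Rc D D₁ θ (rayRadius ψ Rc Zc u θ) / D θ (rayRadius ψ Rc Zc u θ) :=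
  (Λ.hasDerivAt_volumeDerivE hψ hR hD₁ hD₁c hu).deriv

/-- `Ψ′ = 2π` (Jardin's orientation, label `Ψ`). [cite: Jardin2010, §5.3 eq. (5.32)] -/
theorem ggjData_Ψ' (g C : ℝ) (ψ : ℝ → ℝ → ℝ) (Rc Zc u : ℝ) : (ggjData g C ψ Rc Zc u).Ψ' = 2 * π := rfl

/-- `Ψ″ = 0`. [cite: Jardin2010, §5.3 eq. (5.32)] -/
theorem ggjData_Ψ'' (g C : ℝ) (ψ : ℝ → ℝ → ℝ) (Rc Zc u : ℝ) : (ggjData g C ψ Rc Zc u).Ψ'' = 0 := rfl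

/-- `K′ = 0` (constant `F`). [cite: Jardin2010, §5.3 eq. (5.33)] -/
theorem ggjData_K' (g C : ℝ) (ψ : ℝ → ℝ → ℝ) (Rc Zc u : ℝ) : (ggjData g C ψ Rc Zc u).K' = 0 := rfl

/-- `p′ = −C` (`μ₀p′ = −Δ*Ψ/R²`, `Δ*Ψ = C·R²`). [cite: Jardin2010, §4.4 eq. (4.51)] -/
theorem ggjData_p' (g C : ℝ) (ψ : ℝ → ℝ → ℝ) (Rc Zc u : ℝ) : (ggjData g C ψ Rc Zc u).p' = -C := rfl

/-- `Φ′ = g∫₀^{2π} polarKernel`. [cite: Jardin2010, §5.3 eq. (5.31)] -/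
theorem ggjData_Φ' (Λ : LevelLoop ψ Rc Zc uin uout D N t σ₁ σ₂) (g C : ℝ)
    (hψ : ∀ j < N, ∀ θ ∈ Icc (t j) (t (j + 1)), ∀ s ∈ Icc (σ₁ j) (σ₂ j),
      HasFDerivAt (fun p : ℝ × ℝ => ψ p.1 p.2) (L θ s) (rayPoint Rc Zc θ s))
    (hR : ∀ j < N, ∀ θ ∈ Icc (t j) (t (j + 1)), ∀ s ∈ Icc (σ₁ j) (σ₂ j), 0 < Rc + s * cos θ)
    {u : ℝ} (hu : u ∈ Ioo uin uout) :
    (ggjData g C ψ Rc Zc u).Φ' = g * ∫ θ in (0 : ℝ)..(2 * π), polarKernel Rc D θ (rayRadius ψ Rc Zc u θ) :=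
  Λ.toroidalFluxDerivJ_eq_polar g hψ hR hu

/-- `Φ″ = g∫₀^{2π} polarKernelDs/D` along `ρ_u`. [cite: Jardin2010, §8.5.4 eq. (8.134)] -/
theorem ggjData_Φ'' (Λ : LevelLoop ψ Rc Zc uin uout D N t σ₁ σ₂) (g C : ℝ)
    (hψ : ∀ j < N, ∀ θ ∈ Icc (t j) (t (j + 1)), ∀ s ∈ Icc (σ₁ j) (σ₂ j),
      HasFDerivAt (fun p : ℝ × ℝ => ψ p.1 p.2) (L θ s) (rayPoint Rc Zc θ s))
    (hR : ∀ j < N, ∀ θ ∈ Icc (t j) (t (j + 1)), ∀ s ∈ Icc (σ₁ j) (σ₂ j), 0 < Rc + s * cos θ)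
    (hD₁ : ∀ j < N, ∀ θ ∈ Icc (t j) (t (j + 1)), ∀ s ∈ Icc (σ₁ j) (σ₂ j), HasDerivAt (D θ) (D₁ θ s) s)
    (hD₁c : ∀ j < N, ContinuousOn (fun p : ℝ × ℝ => D₁ p.1 p.2) (Icc (t j) (t (j + 1)) ×ˢ Icc (σ₁ j) (σ₂ j)))
    {u : ℝ} (hu : u ∈ Ioo uin uout) :
    (ggjData g C ψ Rc Zc u).Φ''
      = g * ∫ θ in (0 : ℝ)..(2 * π), polarKernelDs Rc D D₁ θ (rayRadius ψ Rc Zc u θ) / D θ (rayRadius ψ Rc Zc u θ) :=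
  (Λ.hasDerivAt_toroidalFluxDerivJ g hψ hR hD₁ hD₁c hu).deriv

/-- `I′ = ∫₀^{2π} curKernelDs/D` along `ρ_u` (given `ψ_R² + ψ_Z² = G`, `∂_sG = G₁` on the boxes).
[cite: Jardin2010, §8.5.4 eq. (8.134)] -/
theorem ggjData_I' (Λ : LevelLoop ψ Rc Zc uin uout D N t σ₁ σ₂) (g C : ℝ)
    (hψ : ∀ j < N, ∀ θ ∈ Icc (t j) (t (j + 1)), ∀ s ∈ Icc (σ₁ j) (σ₂ j),
      HasFDerivAt (fun p : ℝ × ℝ => ψ p.1 p.2) (L θ s) (rayPoint Rc Zc θ s))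
    (hR : ∀ j < N, ∀ θ ∈ Icc (t j) (t (j + 1)), ∀ s ∈ Icc (σ₁ j) (σ₂ j), 0 < Rc + s * cos θ)
    (hG : ∀ j < N, ∀ θ ∈ Icc (t j) (t (j + 1)), ∀ s ∈ Icc (σ₁ j) (σ₂ j), (L θ s (1, 0)) ^ 2 + (L θ s (0, 1)) ^ 2 = G θ s)
    (hD₁ : ∀ j < N, ∀ θ ∈ Icc (t j) (t (j + 1)), ∀ s ∈ Icc (σ₁ j) (σ₂ j), HasDerivAt (D θ) (D₁ θ s) s)
    (hD₁c : ∀ j < N, ContinuousOn (fun p : ℝ × ℝ => D₁ p.1 p.2) (Icc (t j) (t (j + 1)) ×ˢ Icc (σ₁ j) (σ₂ j)))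
    (hG₁ : ∀ j < N, ∀ θ ∈ Icc (t j) (t (j + 1)), ∀ s ∈ Icc (σ₁ j) (σ₂ j), HasDerivAt (G θ) (G₁ θ s) s)
    (hGc : ∀ j < N, ContinuousOn (fun p : ℝ × ℝ => G p.1 p.2) (Icc (t j) (t (j + 1)) ×ˢ Icc (σ₁ j) (σ₂ j)))
    (hG₁c : ∀ j < N, ContinuousOn (fun p : ℝ × ℝ => G₁ p.1 p.2) (Icc (t j) (t (j + 1)) ×ˢ Icc (σ₁ j) (σ₂ j)))
    {u : ℝ} (hu : u ∈ Ioo uin uout) :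
    (ggjData g C ψ Rc Zc u).I'
      = ∫ θ in (0 : ℝ)..(2 * π), curKernelDs Rc D D₁ G G₁ θ (rayRadius ψ Rc Zc u θ) / D θ (rayRadius ψ Rc Zc u θ) :=
  (Λ.hasDerivAt_toroidalCurrentJ hψ hR hG hD₁ hD₁c hG₁ hGc hG₁c hu).deriv

end LevelLoop

/-! ## §3 Jardin's `F` of the surface (poloidal-flux-label form) -/

/-- **Jardin's `F` (8.134) of the implicit surface** in the poloidal-flux-label form (`Ψ′ = 2π`, `Ψ″ = 0`, `K′ = 0`; the `I′`
field drops): `F = (2π)²Φ″²/(4V′²) + 2πΦ″⟨σB²/G⟩/V′ + (⟨σB²/G⟩² − ⟨σ²B²/G⟩⟨B²/G⟩) − C²⟨1/B²⟩⟨B²/G⟩ − CV″⟨B²/G⟩/V′`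
(`mercierF_of_poloidalFluxLabel`). [cite: Jardin2010, §8.5.4 eq. (8.134)] -/
theorem mercierF_ggjData (g C : ℝ) (ψ : ℝ → ℝ → ℝ) (Rc Zc u : ℝ) :
    (ggjData g C ψ Rc Zc u).mercierF
      = (2 * π) ^ 2 * (ggjData g C ψ Rc Zc u).Φ'' ^ 2 / (4 * (ggjData g C ψ Rc Zc u).V' ^ 2)
        + 2 * π * (ggjData g C ψ Rc Zc u).Φ'' / (ggjData g C ψ Rc Zc u).V' * (ggjData g C ψ Rc Zc u).gσB2
        + ((ggjData g C ψ Rc Zc u).gσB2 ^ 2 - (ggjData g C ψ Rc Zc u).gσ2B2 * (ggjData g C ψ Rc Zc u).gB2)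
        - C ^ 2 * (ggjData g C ψ Rc Zc u).invB2 * (ggjData g C ψ Rc Zc u).gB2
        + 1 / (ggjData g C ψ Rc Zc u).V' * (-C * (ggjData g C ψ Rc Zc u).V'') * (ggjData g C ψ Rc Zc u).gB2 := by
  rw [SurfaceData.mercierF_of_poloidalFluxLabel _ (2 * π) rfl rfl]
  simp only [ggjData]
  ring

/-- The `I′` field is irrelevant to the criterion here (it multiplies `Ψ″ = 0`). [cite: Jardin2010, §8.5.4 eq. (8.134)] -/
theorem mercierF_ggjData_indep_I' (g C : ℝ) (ψ : ℝ → ℝ → ℝ) (Rc Zc u x : ℝ) :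
    ({ ggjData g C ψ Rc Zc u with I' := x } : SurfaceData).mercierF = (ggjData g C ψ Rc Zc u).mercierF := by
  simp only [SurfaceData.mercierF, ggjData]
  ring

end PolarRay

end Summit.Ventures.FusionMHD.Models

end
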